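import Summits.HodgeConjecture.CorCM.D2Bridge.ClosedPrintedMuKeyIdentLemD3DelRecConjOmegaT
import Literature.NumberTheory.Automorphic.Liu2021.Def411WeilCarriersTripleSeparation
import Literature.NumberTheory.Automorphic.Liu2021.Thm418TransportNonIso
import HarnessLib

/-!
# [Liu 2021, Thm 4.18 (2)] «mutually non-isomorphic» at the CONJUGATE SPACE's transported datum `D′` — REDUCED to the A-IV rows `hD3`, `hD1''`

Cell `hodgecm-mathlib` (D-0151), fan A, rung A-III, skeleton `Lines/a3-liu418.lean` (sha16 131d50a2abf5e9b8), stub `stub_nonIso : StubNonIso`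
(KEY `a3-noniso-one-place`, strategy «separate at ONE finite place + Flath factor extraction»).

`StubNonIso` is, for every `hDel` and every face prefix `(F, ι₁, V, a, Φ, ν, Φ′)`, item (2) of [Liu2021, Thm. 4.18] AS PRINTED for the transported
datum `D′ = (toThm418Data ℭ_V ((muConj 𝕌_V).rest t_ν)).transport 𝔾_{V^c} (adelicFinConj V)⁻¹ Eps (epsOf δ′) Chi (𝕌_{V^c}.omega ν hν) (𝕌_{V^c}.rho ν hν)`
of the headline `hc_cm_of_printed_citations_muKey_ident_lemD3_delRecConjOmegaT`: the conjugate space's own [Def. 4.11] summands `ω_{V^c}(ν, ε, χ)` over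
`ν`-admissible `(ε, χ)` are pairwise non-isomorphic `ℂ[U(V^c)(𝔸_{F⁺,f})]`-modules (`Thm418Data.AreIsomorphic i j → i = j`).

Print: «Statement (2) follows from Lemma D.1» (FJcycle.tex l. 2270).  Its inputs are the LOCAL [App. D Lem. D.1 (1), (3)] — in the headline these are
the displayed rows `hD1''` and `hD3` (A-IV binders), typed over the tree's own local Weil data of `V` at every finite place of `F⁺`.  An unconditional
proof of the stub IS a proof of those rows' content (local theta dichotomy for `U(3) × U(1)`, IV-4 ABSENT in the tree); this file proves the stub
FROM the two rows, read at the face `(F, V, a, Φ)` — so item (2) of `hLiu418` costs NOTHING beyond A-IV: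

* §1 = ✔ `Thm418Data.nonIso_transport` (`Liu2021/Thm418TransportNonIso.lean`, p593138): item (2) passes along `Thm418Data.transport` given an
  injective index map and `φ`-equivariant summand isomorphisms (the item-(2) slice of ✔ `Thm418Data.thm418AsPrinted_transport`).
* §2 (generic, `UniformOmega`) `nonIso_muConj_rest` — item (2) at the `νᶜ`-rest of `U` gives it at the `ν`-rest of `muConj U` (✔ `admIndexMuConjEquiv`,
  summands equal on the nose); `nonIso_muConj_rest_transport` — then along any re-presentation `(φ, eε, eχ, Ω)` (§1-shape of ✔ `MuConjIdent`).
* §3 (V's own family) `nonIso_rest_uniformOmegaRep_of_lemD1AsPrinted` — at `toThm418Data ℭ_V (𝕌_V.rest t)`, `𝕌_V = uniformOmegaRep … (2δ_F)⁻¹ (fun _ _ => r)`,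
  from `ιV` onto, the pair-form row `hD1R` (= `hD1''` at one `(a, μ)`) and the indexed row `hD3` (= `hD3` at one `a`): engine ✔
  `Def411WeilCarriers.locF_eq_and_chi_eq_of_equiv_of_lemD1AsPrintedI` on the index type `AdmIndex` (one `μ`), non-vanishing ✔
  `nontrivial_omegaAt_restOfCharDeltaPrime_of_lemD1AsPrinted`, faithfulness `Rep.locF_toFun` (admissible collections are global, ✔ `exists_locF_eq_epsOf`).
* §4 (face of record) `nonIso_transport_hermConj_of_lemD1AsPrinted` — item (2) for `D′` from the rows at `(F, V, a, Φ)` and label `νᶜ`: §3 at `νᶜ`, §2 with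
  Part VI ✔ `HComp.OmegaConj.exists_uniformOmegaRep_conj_hermConj`, `epsNegEquiv`, `chiInv` (verbatim the transport data of ✔
  `MuConjIdent.thm418AsPrinted_muConj_rest_transport_hermConj`).
* §5 `stubNonIso_of_hD3_hD1pp` — `StubNonIso` VERBATIM (the skeleton's `def`, unfolded) from the headline's rows `hD3`, `hD1''` closed over `hDel`
  (= the certificate module's `HypD3`, `HypD1pp`, character-for-character).

ORIENTATION: none used — item (2) is orientation-free (A-plan/A3-ORIENTATION.md §3.3 untouched).
HC_CM is proved only modulo the 7 printed citations (`hDel`, `h21`, `hLiu418`, `h411`, `h413`, `hD3`, `hD1''`) until rung 0 closes; this file asserts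
nothing of [Liu2021]: both Lemma-D.1 rows are HYPOTHESES of every theorem here.

References: [Liu2021] Y. Liu, *Fourier–Jacobi cycles and arithmetic relative trace formula*, Camb. J. Math. 9 (2021) = arXiv:2102.11518, Thm. 4.18 (2)
(l. 2241) with proof l. 2270, Def. 4.11–4.12, Rem. 4.4, App. D Lem. D.1 (1), (3) (l. 5229, 5233); [Flath1979] D. Flath, *Decomposition of representations
into tensor products*, Corvallis I, Thm. 3 (uniqueness).
-/

set_option autoImplicit false

noncomputable section

namespace Summit.HodgeConjecture.CorCM.Lines.A3Liu418

open scoped TensorProduct Matrix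
open NumberField NumberField.InfinitePlace
open HodgeCM.Model HodgeCM.Model.LiuIndex HodgeCM.Model.TowerCarrier
open Summit.HodgeConjecture.CorCM.Model
open Literature.AlgebraicGeometry.Motives (CMType)
open Literature.AlgebraicGeometry.HodgeTheory Literature.NumberTheory.Automorphic.PicardCM
open Literature.AlgebraicGeometry.ShimuraVarieties.UnitaryCanonicalModel
open Literature.NumberTheory.ComplexMultiplication
open Literature.NumberTheory.Automorphic
open Literature.NumberTheory.Automorphic.IdeleClassGroup (toHeckeCharacter isUnitary_toHeckeCharacter galConj)
open Literature.NumberTheory.Automorphic.Liu2021 Literature.NumberTheory.Automorphic.Liu2021.AppendixC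
open Literature.NumberTheory.Automorphic.Liu2021.AppendixC.RestOne
open Literature.NumberTheory.Automorphic.Liu2021.Def411WeilCarriers (lineOf locF Rep Eps epsOf Chi)
open Summit.HodgeConjecture.CorCM.Transposition.OmegaTransport (realUnit)
open HodgeCM.Model.ArchSideTerm (e₁)
open Literature.NumberTheory.GelbartRogawski1991 Literature.NumberTheory.GelbartRogawski1991.UnitaryDualPair
open Literature.NumberTheory.GelbartRogawski1991.UnitaryDualPair.LocalSplitting (localMu norm_localMu continuous_localMu localMu_toLocalRing_eq_one_iff
  eq_of_forall_localMu_toHeckeCharacter_eq)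
open Literature.RepresentationTheory Literature.RepresentationTheory.Liu2021
open Literature.AlgebraicGeometry.Liu2021 (IsAdmissibleElement)
open Summit.HodgeConjecture.CorCM.Transposition
open Summit.HodgeConjecture.CorCM.HComp.OmegaConj
open Summit.HodgeConjecture.CorCM.D2Bridge.AdapterMuConj (muConj admIndexMuConjEquiv)
open Summit.HodgeConjecture.CorCM.D2Bridge.MuConjIdent (repConj epsNegEquiv epsOf_neg_of_complexConj_eq_neg map_negOne_mul_map_negOne_mul)
open Summit.HodgeConjecture.CorCM.D2Bridge.MuKeyIdentLemD3DelRecConjOmegaEnd (diagonal_frameD_map_complexConj)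

/-! ## §2 Item (2) along `μ ↦ μᶜ` (`AdapterMuConj.muConj`) and along a re-presentation of the relabelled rest -/

section MuConj

variable {F₀ E₀ : Type} {iF₁ : Field F₀} {iF₂ : NumberField F₀} {iF₃ : IsTotallyReal F₀} {iE₁ : Field E₀} {iE₂ : NumberField E₀}
  {iA : Algebra F₀ E₀} {iE₃ : IsTotallyComplex E₀} {iQ : Algebra.IsQuadraticExtension F₀ E₀}
variable {P5 : PropC5Data F₀ E₀} {isotropicAt : ℕ → Prop} {C : Sec42Data P5 isotropicAt}

/-- **Item (2) transfers along `μ = νᶜ`**: the summands of [Thm. 4.18] at the `ν`-rest of `muConj U` ARE those at the `μ`-rest of `U` (✔ `muConj_omega`,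
`rfl`), along the index correspondence ✔ `admIndexMuConjEquiv` (identity on `(ε, χ)`); so pairwise non-isomorphy at the `μ`-rest of `U` gives it at the
`ν`-rest of `muConj U`. [cite: Liu2021, Thm. 4.18 (2) (l. 2241), Rem. 4.4, Def. 4.12 (l. 2108–2111)] -/
theorem nonIso_muConj_rest (U : UniformOmega C) {μ ν : Literature.NumberTheory.Automorphic.IdeleClassGroup E₀ →ₜ* Circle}
    {hμ : letI : IsCMField E₀ := isCMField F₀ E₀; IdeleClassGroup.IsConjugateSymplectic E₀ μ}
    {hν : letI : IsCMField E₀ := isCMField F₀ E₀; IdeleClassGroup.IsConjugateSymplectic E₀ ν}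
    (t : RestTail C μ hμ) (tc : RestTail C ν hν)
    (h : letI : IsCMField E₀ := isCMField F₀ E₀; μ = galConj (IsCMField.complexConj E₀) ν)
    (h2 : ∀ i j : (toThm418Data C (U.rest t)).AdmIndex, (toThm418Data C (U.rest t)).AreIsomorphic i j → i = j) :
    ∀ i' j' : (toThm418Data C ((muConj U).rest tc)).AdmIndex,
      (toThm418Data C ((muConj U).rest tc)).AreIsomorphic i' j' → i' = j' := by
  subst h
  intro i' j' hij
  obtain ⟨f, hf⟩ := hij
  exact (admIndexMuConjEquiv U t tc rfl).symm.injective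
    (h2 ((admIndexMuConjEquiv U t tc rfl).symm i') ((admIndexMuConjEquiv U t tc rfl).symm j') ⟨f, hf⟩)

/-- **Item (2) for the relabelled rest `(muConj U).rest t` transports along any re-presentation** of the group (`φ : G′ ≃ₜ* 𝔾(𝔸_F^∞)`), of the index
types (`eε : Eps′ ≃ U.Eps`, `eχ : Chi′ ≃ U.Chi`, collections map `epsOf′` with `U.epsOf (−x) = eε (epsOf′ x)` on admissible `x`) and of the summands
(`Ω ε′ χ′ : U.omega νᶜ (eε ε′) (eχ χ′) ≃ₗ[ℂ] ω′ ε′ χ′` intertwining `U.rho … (φ g′)` with `ρ′ … g′`) — the item-(2) slice of ✔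
`MuConjIdent.thm418AsPrinted_muConj_rest_transport` (same binder list), by §1 with the index bijection `(ε′, χ′) ↦ (eε ε′, eχ χ′)`.
[cite: Liu2021, Thm. 4.18 (2) (l. 2241), Def. 4.12 (l. 2102–2111), Rem. 4.4] -/
theorem nonIso_muConj_rest_transport (U : UniformOmega C)
    {ν : Literature.NumberTheory.Automorphic.IdeleClassGroup E₀ →ₜ* Circle}
    {hν : letI : IsCMField E₀ := isCMField F₀ E₀; IdeleClassGroup.IsConjugateSymplectic E₀ ν} (t : RestTail C ν hν)
    (G' : Type) [Group G'] [TopologicalSpace G'] [IsTopologicalGroup G'] (φ : G' ≃ₜ* C.G)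
    (Eps' : Type) (epsOf' : E₀ → Eps') (Chi' : Type) (omega' : Eps' → Chi' → Type)
    [∀ ε χ, AddCommGroup (omega' ε χ)] [∀ ε χ, Module ℂ (omega' ε χ)]
    (rho' : ∀ ε χ, Representation ℂ G' (omega' ε χ))
    (eε : Eps' ≃ U.Eps) (eχ : Chi' ≃ U.Chi)
    (hneg : ∀ x : E₀, (letI : IsCMField E₀ := isCMField F₀ E₀;
        IsAdmissibleElement E₀ (AppendixC.toThm418Data C ((muConj U).rest t)).cmType.1 x) →
        U.epsOf (-x) = eε (epsOf' x))
    (Ω : ∀ ε χ, U.omega _ (letI : IsCMField E₀ := isCMField F₀ E₀; hν.galConj) (eε ε) (eχ χ) ≃ₗ[ℂ] omega' ε χ)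
    (hΩ : ∀ ε χ (g' : G') (x : U.omega _ (letI : IsCMField E₀ := isCMField F₀ E₀; hν.galConj) (eε ε) (eχ χ)),
      Ω ε χ (U.rho _ _ (eε ε) (eχ χ) (φ g') x) = rho' ε χ g' (Ω ε χ x))
    (h2 : ∀ i j : (AppendixC.toThm418Data C ((muConj U).rest t)).AdmIndex,
      (AppendixC.toThm418Data C ((muConj U).rest t)).AreIsomorphic i j → i = j) :
    ∀ i' j' : ((AppendixC.toThm418Data C ((muConj U).rest t)).transport G' φ Eps' epsOf' Chi' omega' rho').AdmIndex,
      ((AppendixC.toThm418Data C ((muConj U).rest t)).transport G' φ Eps' epsOf' Chi' omega' rho').AreIsomorphic i' j' →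
        i' = j' := by
  letI : IsCMField E₀ := isCMField F₀ E₀
  -- [Def. 4.12] on collections: admissibility at the two collection maps corresponds under `eε` (as in ✔ `thm418AsPrinted_muConj_rest_transport`)
  have hadm : ∀ ε' : Eps',
      ((AppendixC.toThm418Data C ((muConj U).rest t)).transport G' φ Eps' epsOf' Chi' omega' rho').IsAdmissible ε' →
        (AppendixC.toThm418Data C ((muConj U).rest t)).IsAdmissible (eε ε') := by
    rintro ε' ⟨x, hx, hxε⟩
    refine ⟨x, hx, ?_⟩
    change U.epsOf (-x) = eε ε'
    rw [hneg x hx]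
    exact congrArg eε hxε
  refine Thm418Data.nonIso_transport (AppendixC.toThm418Data C ((muConj U).rest t)) G' φ Eps' epsOf' Chi' omega' rho'
    (fun i' => ⟨(eε i'.1.1, eχ i'.1.2), hadm _ i'.2⟩) (fun i' j' hij => ?_) (fun i' => (Ω i'.1.1 i'.1.2).symm) ?_ h2
  · have h1 := congrArg (fun i : (AppendixC.toThm418Data C ((muConj U).rest t)).AdmIndex => i.1) hij
    exact Subtype.ext (Prod.ext (eε.injective (congrArg Prod.fst h1)) (eχ.injective (congrArg Prod.snd h1)))
  · intro i' g' y
    change (Ω i'.1.1 i'.1.2).symm (rho' i'.1.1 i'.1.2 g' y) =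
      U.rho _ hν.galConj (eε i'.1.1) (eχ i'.1.2) (φ g') ((Ω i'.1.1 i'.1.2).symm y)
    rw [LinearEquiv.symm_apply_eq, hΩ, LinearEquiv.apply_symm_apply]

end MuConj

/-! ## §3 Item (2) for `V`'s OWN μ-uniform family at one label `μ`, from [Lem. D.1 (1), (3)] AS PRINTED per place (the rows `hD1''`, `hD3` at one scalar) -/

section OwnFamily

/-- **[Liu2021, Thm. 4.18 (2)] at `V`'s own rest `𝔯δ′⟦r, μ⟧ = restOfCharDeltaPrime … r μ hμ hw`** (= `toThm418Data ℭ_V (𝕌_V.rest t_μ)`,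
`𝕌_V = uniformOmegaRep … (2δ_F)⁻¹ (fun _ _ => r)`, ✔ `restOfCharRep_eq_rest`) **from [App. D Lem. D.1 (1), (3)] AS PRINTED per place** («Statement (2)
follows from Lemma D.1», l. 2270): for `ιV` onto, the PAIR-form row `hD1R` (= the headline's `hD1''` at one `(a, μ)`) and the INDEXED row `hD3`
(= the headline's `hD3` at one `a`; index type `(μw : {μ // conj.-sympl. ∧ weight 1}) × AdmIndex 𝔯δ′⟦r, μw⟧`), two admissible indices `i, j` with
`ω_i ≃ ω_j` `𝔾(𝔸_F^∞)`-equivariantly are EQUAL.  Route: `ω_i ≠ 0` by [Lem. D.1 (1)] (✔ `nontrivial_omegaAt_restOfCharDeltaPrime_of_lemD1AsPrinted`,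
`n ≥ 3`); restriction to `U(J_V)(F⁺_v)` [Flath Thm 3] and Lem. D.1 (3)'s class- and `χ`-clauses per place, globalised (✔
`Def411WeilCarriers.locF_eq_and_chi_eq_of_equiv_of_lemD1AsPrintedI`, run on the index type `AdmIndex` at the one label `μ`, the displayed
Σ-family read on it by ✔ `LemD1_3AsPrintedI.comap`); admissible collections are global (✔ `exists_locF_eq_epsOf`) and recovered by the faithful
section `r` (`Rep.locF_toFun`).  Nothing of [Liu2021] is asserted.
[cite: Liu2021, Def. 4.11 (l. 2083–2097), Def. 4.12 (l. 2102–2108), Thm. 4.18 (2) (l. 2241) with proof l. 2270, App. D Lem. D.1 (1), (3) (l. 5229, 5233)]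
[cite: FlathCorvallis1979, Theorem 3 (uniqueness clause)] -/
theorem nonIso_restOfCharDeltaPrime_of_lemD1AsPrinted (h : exists_recordSystem) (F : CMField) [IsGalois ℚ F]
    (h6 : 6 ≤ Module.finrank ℚ F) (ι₁ : F →+* ℂ) (V : HermSpace3 F ι₁) (Φ : CMType F) {n : ℕ} (e : Fin 3 × Fin 1 ≃ Fin n) (dV : Fin 3 → F)
    (hdV : ∀ i, IsCMField.complexConj F (dV i) = dV i) (hdV0 : ∀ i, dV i ≠ 0)
    (ιV : (sec42DataOf h isoOf F ι₁ V Φ).G →* UnitaryGroup.finAdelic ↥(maximalRealSubfield F) F (IsCMField.complexConj F) 3 (Matrix.diagonal dV))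
    (r : Rep ↥(maximalRealSubfield F) (imagUnitSq F)) (hn : 3 ≤ n) (hιV : Function.Surjective ιV)
    (μ : Literature.NumberTheory.Automorphic.IdeleClassGroup F →ₜ* Circle) (hμ : IdeleClassGroup.IsConjugateSymplectic F μ)
    (hw : IdeleClassGroup.HasWeight F μ 1)
    (hD1R : ∀ (j : (toThm418Data _ (restOfCharDeltaPrime h F h6 ι₁ V Φ e dV hdV hdV0 ιV r μ hμ hw)).AdmIndex) (v : IsDedekindDomain.HeightOneSpectrum (𝓞 ↥(maximalRealSubfield F))),
      LemD1_1AsPrinted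
        (Def411WeilCarriers.localLemD1Data ↥(maximalRealSubfield F) F (IsCMField.complexConj F) 3 e (Matrix.diagonal dV) (complexConj_imagUnit F) (imagUnit_ne_zero F) (imagUnit_mul_self F) (realDiagonal_isSymm F dV hdV) (isUnit_det_realDiagonal F dV hdV hdV0) (realDiagonal_map F dV hdV).symm (r.toFun j.1.1)
          (OmegaChiSplitting.chiLocalSplittingsD F e dV hdV hdV0 (toHeckeCharacter F μ) ((isOscillatorChar_toHeckeCharacter_iff μ).mpr hμ) (r.toFun j.1.1))
          hn (localMu F (toHeckeCharacter F μ)) (fun v x => norm_localMu F (toHeckeCharacter F μ) v (isUnitary_toHeckeCharacter F μ) x)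
          (continuous_localMu F (toHeckeCharacter F μ))
          (fun v t => localMu_toLocalRing_eq_one_iff F (toHeckeCharacter F μ) v ((isOscillatorChar_toHeckeCharacter_iff μ).mpr hμ) t)
          j.1.2.1
          (Def411WeilCarriers.norm_chi_eq_one ↥(maximalRealSubfield F) F (IsCMField.complexConj F) (Algebra.IsQuadraticExtension.finrank_eq_two ↥(maximalRealSubfield F) F)
            (UnitaryGroup.algEquiv_ne_one_of_apply_eq_neg ↥(maximalRealSubfield F) F (IsCMField.complexConj F) (complexConj_imagUnit F) (imagUnit_ne_zero F)) j.1.2)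
          j.1.2.2.1 v))
    (hD3 : ∀ v : IsDedekindDomain.HeightOneSpectrum (𝓞 ↥(maximalRealSubfield F)), LemD1_3AsPrintedI
      (Def411WeilCarriers.localIndexedFamilyAtV (ι := ((μw : {μ : Literature.NumberTheory.Automorphic.IdeleClassGroup F →ₜ* Circle // IdeleClassGroup.IsConjugateSymplectic F μ ∧ IdeleClassGroup.HasWeight F μ 1}) × (toThm418Data _ (restOfCharDeltaPrime h F h6 ι₁ V Φ e dV hdV hdV0 ιV r μw.1 μw.2.1 μw.2.2)).AdmIndex)) ↥(maximalRealSubfield F) F (IsCMField.complexConj F) 3 e (Matrix.diagonal dV) (complexConj_imagUnit F) (imagUnit_ne_zero F) (imagUnit_mul_self F) (realDiagonal_isSymm F dV hdV) (isUnit_det_realDiagonal F dV hdV hdV0) (realDiagonal_map F dV hdV).symm hn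
        (fun t => r.toFun t.2.1.1) (fun t => t.2.1.2)
        (fun t => OmegaChiSplitting.chiLocalSplittingsD F e dV hdV hdV0 (toHeckeCharacter F t.1.1) ((isOscillatorChar_toHeckeCharacter_iff t.1.1).mpr t.1.2.1) (r.toFun t.2.1.1))
        (fun t => localMu F (toHeckeCharacter F t.1.1))
        (fun t v x => norm_localMu F (toHeckeCharacter F t.1.1) v (isUnitary_toHeckeCharacter F t.1.1) x)
        (fun t => continuous_localMu F (toHeckeCharacter F t.1.1))
        (fun t v x => localMu_toLocalRing_eq_one_iff F (toHeckeCharacter F t.1.1) v ((isOscillatorChar_toHeckeCharacter_iff t.1.1).mpr t.1.2.1) x) v)) :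
    ∀ i j : (toThm418Data _ (restOfCharDeltaPrime h F h6 ι₁ V Φ e dV hdV hdV0 ιV r μ hμ hw)).AdmIndex,
      (toThm418Data _ (restOfCharDeltaPrime h F h6 ι₁ V Φ e dV hdV hdV0 ιV r μ hμ hw)).AreIsomorphic i j → i = j := by
  intro i j hij
  -- [Lem. D.1 (1)] ⇒ `ω_i ≠ 0` (`n ≥ 3`, `ιV` onto)
  have hnt := nontrivial_omegaAt_restOfCharDeltaPrime_of_lemD1AsPrinted h F h6 ι₁ V Φ e dV hdV hdV0 ιV r μ hμ hw hιV hn i (hD1R i)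
  -- restriction [Flath Thm 3] + Lem. D.1 (3) per place, on the index type `AdmIndex` at the one label `μ`
  have key := Def411WeilCarriers.locF_eq_and_chi_eq_of_equiv_of_lemD1AsPrintedI
    (ι := (toThm418Data _ (restOfCharDeltaPrime h F h6 ι₁ V Φ e dV hdV hdV0 ιV r μ hμ hw)).AdmIndex)
    ↥(maximalRealSubfield F) F (IsCMField.complexConj F) 3 (Matrix.diagonal dV) (complexConj_imagUnit F) (imagUnit_ne_zero F) e (imagUnit_mul_self F)
    (realDiagonal_isSymm F dV hdV) (isUnit_det_realDiagonal F dV hdV hdV0) (realDiagonal_map F dV hdV).symm hn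
    (fun k => r.toFun k.1.1) (fun k => k.1.2)
    (fun k => OmegaChiSplitting.chiLocalSplittingsD F e dV hdV hdV0 (toHeckeCharacter F μ) ((isOscillatorChar_toHeckeCharacter_iff μ).mpr hμ)
      (r.toFun k.1.1))
    (fun _ => localMu F (toHeckeCharacter F μ))
    (fun _ v x => norm_localMu F (toHeckeCharacter F μ) v (isUnitary_toHeckeCharacter F μ) x)
    (fun _ => continuous_localMu F (toHeckeCharacter F μ))
    (fun _ v x => localMu_toLocalRing_eq_one_iff F (toHeckeCharacter F μ) v ((isOscillatorChar_toHeckeCharacter_iff μ).mpr hμ) x)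
    (fun _ a => OmegaChiSplitting.hsChiD F e dV hdV hdV0 (toHeckeCharacter F μ) (isUnitary_toHeckeCharacter F μ)
      ((isOscillatorChar_toHeckeCharacter_iff μ).mpr hμ) a)
    (fun k => OmegaChiSplitting.hfac_sChiD F e dV hdV hdV0 (toHeckeCharacter F μ) (isUnitary_toHeckeCharacter F μ)
      ((isOscillatorChar_toHeckeCharacter_iff μ).mpr hμ) (r.toFun k.1.1))
    (fun k v => hD1R k v)
    (fun v => by
      -- the displayed Σ-indexed family READ ON the indices at the one label `μ` (✔ `LemD1_3AsPrintedI.comap`), both families unfolded to their fields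
      have h3 := (hD3 v).comap fun k : (toThm418Data _ (restOfCharDeltaPrime h F h6 ι₁ V Φ e dV hdV hdV0 ιV r μ hμ hw)).AdmIndex =>
        (⟨⟨μ, hμ, hw⟩, k⟩ : ((μw : {μ : Literature.NumberTheory.Automorphic.IdeleClassGroup F →ₜ* Circle // IdeleClassGroup.IsConjugateSymplectic F μ ∧ IdeleClassGroup.HasWeight F μ 1}) × (toThm418Data _ (restOfCharDeltaPrime h F h6 ι₁ V Φ e dV hdV hdV0 ιV r μw.1 μw.2.1 μw.2.2)).AdmIndex))
      dsimp only [LemD1IndexedFamily.comap, Def411WeilCarriers.localIndexedFamilyAtV] at h3 ⊢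
      exact h3)
    hιV i j hnt hij
  -- admissible collections are GLOBAL, and the faithful section `r` recovers them (`Rep.locF_toFun`)
  have hglob : ∀ k : (toThm418Data _ (restOfCharDeltaPrime h F h6 ι₁ V Φ e dV hdV hdV0 ιV r μ hμ hw)).AdmIndex,
      ∃ a, locF ↥(maximalRealSubfield F) (imagUnitSq F) a = k.1.1 := fun k => by
    obtain ⟨x, -, hx⟩ := k.2
    obtain ⟨a, ha⟩ := Def411WeilCarriers.exists_locF_eq_epsOf ↥(maximalRealSubfield F) F (imagUnitSq F) (2 * imagUnit F)⁻¹ x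
    exact ⟨a, ha.trans hx⟩
  have hε : i.1.1 = j.1.1 := ((r.locF_toFun i.1.1 (hglob i)).symm.trans key.1).trans (r.locF_toFun j.1.1 (hglob j))
  exact Subtype.ext (Prod.ext hε key.2)

end OwnFamily

/-! ## §4 The face of record: item (2) at the CONJUGATE SPACE's transported datum from the rows at `(F, V, a, Φ)` and the label `νᶜ` -/

section HermConj

set_option maxHeartbeats 1600000 in
/-- **[Liu2021, Thm. 4.18 (2)] AT THE CONJUGATE SPACE's TRANSPORTED DATUM, from [App. D Lem. D.1 (1), (3)] AS PRINTED per place read on `V`'s OWN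
family at the label `νᶜ`.**  Datum: `(toThm418Data ℭ_V ((muConj 𝕌_V).rest t)).transport 𝔾_{V^c} (adelicFinConj V)⁻¹ Eps (epsOf (2δ_F)⁻¹) Chi
(𝕌_{V^c}.omega ν hν) (𝕌_{V^c}.rho ν hν)` — the conjugate space's own [Def. 4.11] family `𝕌_{V^c} = uniformOmegaRep … V.conj Φ′ … (iotaVConj …) (2δ_F)⁻¹
(repConj F r)` at `ν`, `U(V^c)(𝔸_{F⁺,f})` acting natively, for ANY tail `t` at `ν` (the headline's is the tail of record).  Hypotheses: `ιV` onto, the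
pair-form row `hD1R` at `νᶜ` and the indexed row `hD3` (the headline's `hD1''`, `hD3` at one scalar).  Route: §3 at `νᶜ` (`𝔯δ′⟦r, νᶜ⟧ = 𝕌_V.rest t_{νᶜ}`,
✔ `restOfCharRep_eq_rest`, `rfl`) ⟶ §2 `nonIso_muConj_rest` ⟶ §2 `nonIso_muConj_rest_transport` with the transport data of ✔
`MuConjIdent.thm418AsPrinted_muConj_rest_transport_hermConj` VERBATIM: Part VI ✔ `exists_uniformOmegaRep_conj_hermConj` at `(ε, ε′, χ, χ′) :=
(locF(−1)·ε′, ε′, χ′⁻¹, χ′)`, `eε := epsNegEquiv`, `eχ := chiInv`, `hneg := epsOf_neg_of_complexConj_eq_neg`.  Orientation-free.  Nothing of [Liu2021] is asserted.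
[cite: Liu2021, Thm. 4.18 (2) (l. 2241) with proof l. 2270, Def. 4.11 (l. 2092–2096), Def. 4.12 (l. 2102–2111), Rem. 4.4, App. D Lem. D.1 (1), (2), (3) (l. 5229–5233)]
[cite: FlathCorvallis1979, Theorem 3 (uniqueness clause)] -/
theorem nonIso_transport_hermConj_of_lemD1AsPrinted (h : exists_recordSystem) (F : CMField) [IsGalois ℚ F]
    (h6 : 6 ≤ Module.finrank ℚ F) (ι₁ : F →+* ℂ) (V : HermSpace3 F ι₁) (Φ Φ' : CMType F) {n : ℕ} (e : Fin 3 × Fin 1 ≃ Fin n) (dV : Fin 3 → F)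
    (hdV : ∀ i, IsCMField.complexConj F (dV i) = dV i) (hdV0 : ∀ i, dV i ≠ 0)
    (hJc : (Matrix.diagonal dV).map ((IsCMField.complexConj F : F ≃ₐ[↥(maximalRealSubfield F)] F) : F →+* F) = Matrix.diagonal dV)
    (ιV : (sec42DataOf h isoOf F ι₁ V Φ).G →* UnitaryGroup.finAdelic ↥(maximalRealSubfield F) F (IsCMField.complexConj F) 3 (Matrix.diagonal dV))
    (r : Rep ↥(maximalRealSubfield F) (imagUnitSq F)) (hn : 3 ≤ n) (hιV : Function.Surjective ιV)
    (ν : Literature.NumberTheory.Automorphic.IdeleClassGroup F →ₜ* Circle) (hν : IdeleClassGroup.IsConjugateSymplectic F ν)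
    (tc : RestTail (sec42DataOf h isoOf F ι₁ V Φ) ν hν)
    (hw' : IdeleClassGroup.HasWeight F (galConj (IsCMField.complexConj F) ν) 1)
    (hD1R : ∀ (j : (toThm418Data _ (restOfCharDeltaPrime h F h6 ι₁ V Φ e dV hdV hdV0 ιV r (galConj (IsCMField.complexConj F) ν) hν.galConj hw')).AdmIndex) (v : IsDedekindDomain.HeightOneSpectrum (𝓞 ↥(maximalRealSubfield F))),
      LemD1_1AsPrinted
        (Def411WeilCarriers.localLemD1Data ↥(maximalRealSubfield F) F (IsCMField.complexConj F) 3 e (Matrix.diagonal dV) (complexConj_imagUnit F) (imagUnit_ne_zero F) (imagUnit_mul_self F) (realDiagonal_isSymm F dV hdV) (isUnit_det_realDiagonal F dV hdV hdV0) (realDiagonal_map F dV hdV).symm (r.toFun j.1.1)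
          (OmegaChiSplitting.chiLocalSplittingsD F e dV hdV hdV0 (toHeckeCharacter F (galConj (IsCMField.complexConj F) ν)) ((isOscillatorChar_toHeckeCharacter_iff (galConj (IsCMField.complexConj F) ν)).mpr hν.galConj) (r.toFun j.1.1))
          hn (localMu F (toHeckeCharacter F (galConj (IsCMField.complexConj F) ν))) (fun v x => norm_localMu F (toHeckeCharacter F (galConj (IsCMField.complexConj F) ν)) v (isUnitary_toHeckeCharacter F (galConj (IsCMField.complexConj F) ν)) x)
          (continuous_localMu F (toHeckeCharacter F (galConj (IsCMField.complexConj F) ν)))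
          (fun v t => localMu_toLocalRing_eq_one_iff F (toHeckeCharacter F (galConj (IsCMField.complexConj F) ν)) v ((isOscillatorChar_toHeckeCharacter_iff (galConj (IsCMField.complexConj F) ν)).mpr hν.galConj) t)
          j.1.2.1
          (Def411WeilCarriers.norm_chi_eq_one ↥(maximalRealSubfield F) F (IsCMField.complexConj F) (Algebra.IsQuadraticExtension.finrank_eq_two ↥(maximalRealSubfield F) F)
            (UnitaryGroup.algEquiv_ne_one_of_apply_eq_neg ↥(maximalRealSubfield F) F (IsCMField.complexConj F) (complexConj_imagUnit F) (imagUnit_ne_zero F)) j.1.2)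
          j.1.2.2.1 v))
    (hD3 : ∀ v : IsDedekindDomain.HeightOneSpectrum (𝓞 ↥(maximalRealSubfield F)), LemD1_3AsPrintedI
      (Def411WeilCarriers.localIndexedFamilyAtV (ι := ((μw : {μ : Literature.NumberTheory.Automorphic.IdeleClassGroup F →ₜ* Circle // IdeleClassGroup.IsConjugateSymplectic F μ ∧ IdeleClassGroup.HasWeight F μ 1}) × (toThm418Data _ (restOfCharDeltaPrime h F h6 ι₁ V Φ e dV hdV hdV0 ιV r μw.1 μw.2.1 μw.2.2)).AdmIndex)) ↥(maximalRealSubfield F) F (IsCMField.complexConj F) 3 e (Matrix.diagonal dV) (complexConj_imagUnit F) (imagUnit_ne_zero F) (imagUnit_mul_self F) (realDiagonal_isSymm F dV hdV) (isUnit_det_realDiagonal F dV hdV hdV0) (realDiagonal_map F dV hdV).symm hn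
        (fun t => r.toFun t.2.1.1) (fun t => t.2.1.2)
        (fun t => OmegaChiSplitting.chiLocalSplittingsD F e dV hdV hdV0 (toHeckeCharacter F t.1.1) ((isOscillatorChar_toHeckeCharacter_iff t.1.1).mpr t.1.2.1) (r.toFun t.2.1.1))
        (fun t => localMu F (toHeckeCharacter F t.1.1))
        (fun t v x => norm_localMu F (toHeckeCharacter F t.1.1) v (isUnitary_toHeckeCharacter F t.1.1) x)
        (fun t => continuous_localMu F (toHeckeCharacter F t.1.1))
        (fun t v x => localMu_toLocalRing_eq_one_iff F (toHeckeCharacter F t.1.1) v ((isOscillatorChar_toHeckeCharacter_iff t.1.1).mpr t.1.2.1) x) v)) :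
    ∀ i j : ((AppendixC.toThm418Data (sec42DataOf h isoOf F ι₁ V Φ) ((muConj (uniformOmegaRep h F ι₁ V Φ e dV hdV hdV0 ιV (2 * imagUnit F)⁻¹ (fun _ _ => r))).rest tc)).transport (sec42DataOf h isoOf F ι₁ V.conj Φ').G (HermSpace3.adelicFinConj V).symm (Eps ↥(maximalRealSubfield F) (imagUnitSq F)) (epsOf ↥(maximalRealSubfield F) (imagUnitSq F) F (2 * imagUnit F)⁻¹) (Chi ↥(maximalRealSubfield F) F (IsCMField.complexConj F)) ((uniformOmegaRep h F ι₁ V.conj Φ' e dV hdV hdV0 (iotaVConj h F ι₁ V Φ Φ' dV ιV hJc) (2 * imagUnit F)⁻¹ (repConj F (fun _ _ => r))).omega ν hν) ((uniformOmegaRep h F ι₁ V.conj Φ' e dV hdV hdV0 (iotaVConj h F ι₁ V Φ Φ' dV ιV hJc) (2 * imagUnit F)⁻¹ (repConj F (fun _ _ => r))).rho ν hν)).AdmIndex,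
      ((AppendixC.toThm418Data (sec42DataOf h isoOf F ι₁ V Φ) ((muConj (uniformOmegaRep h F ι₁ V Φ e dV hdV hdV0 ιV (2 * imagUnit F)⁻¹ (fun _ _ => r))).rest tc)).transport (sec42DataOf h isoOf F ι₁ V.conj Φ').G (HermSpace3.adelicFinConj V).symm (Eps ↥(maximalRealSubfield F) (imagUnitSq F)) (epsOf ↥(maximalRealSubfield F) (imagUnitSq F) F (2 * imagUnit F)⁻¹) (Chi ↥(maximalRealSubfield F) F (IsCMField.complexConj F)) ((uniformOmegaRep h F ι₁ V.conj Φ' e dV hdV hdV0 (iotaVConj h F ι₁ V Φ Φ' dV ιV hJc) (2 * imagUnit F)⁻¹ (repConj F (fun _ _ => r))).omega ν hν) ((uniformOmegaRep h F ι₁ V.conj Φ' e dV hdV hdV0 (iotaVConj h F ι₁ V Φ Φ' dV ιV hJc) (2 * imagUnit F)⁻¹ (repConj F (fun _ _ => r))).rho ν hν)).AreIsomorphic i j → i = j := by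
  -- (1) item (2) at `V`'s own `νᶜ`-rest (§3), moved to the `ν`-rest of `muConj 𝕌_V` (§2; `𝔯δ′⟦r, νᶜ⟧ = 𝕌_V.rest t_{νᶜ}` by `rfl`)
  have h2 : ∀ i j : (AppendixC.toThm418Data (sec42DataOf h isoOf F ι₁ V Φ) ((muConj (uniformOmegaRep h F ι₁ V Φ e dV hdV hdV0 ιV (2 * imagUnit F)⁻¹ (fun _ _ => r))).rest tc)).AdmIndex,
      (AppendixC.toThm418Data (sec42DataOf h isoOf F ι₁ V Φ) ((muConj (uniformOmegaRep h F ι₁ V Φ e dV hdV hdV0 ιV (2 * imagUnit F)⁻¹ (fun _ _ => r))).rest tc)).AreIsomorphic i j → i = j :=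
    nonIso_muConj_rest (uniformOmegaRep h F ι₁ V Φ e dV hdV hdV0 ιV (2 * imagUnit F)⁻¹ (fun _ _ => r))
      (restTailOne (AlgHom.id ℚ F) ι₁ hν.galConj hw' (Def45.Carriers.ofPolDR (galConj (IsCMField.complexConj F) ν) (Def45.PolDR ι₁ hν.galConj (Def45.RMuForm ι₁ hν.galConj)))
        ((heckeTranslatesFamilyOf heckeTranslate_definedOver_holds h isoOf F ι₁ V Φ h6).rhoΩOne (AlgHom.id ℚ F) ι₁ hν.galConj hw'
          (Def45.Carriers.ofPolDR (galConj (IsCMField.complexConj F) ν) (Def45.PolDR ι₁ hν.galConj (Def45.RMuForm ι₁ hν.galConj)))))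
      tc rfl (nonIso_restOfCharDeltaPrime_of_lemD1AsPrinted h F h6 ι₁ V Φ e dV hdV hdV0 ιV r hn hιV _ hν.galConj hw' hD1R hD3)
  -- (2) Part VI at every index `(ε′, χ′)`, read at `(ε, χ) := (locF (−1) · ε′, χ′⁻¹)` (verbatim ✔ `thm418AsPrinted_muConj_rest_transport_hermConj`)
  have key : ∀ (ε' : Eps ↥(maximalRealSubfield F) (imagUnitSq F)) (χ' : Chi ↥(maximalRealSubfield F) F (IsCMField.complexConj F)),
      ∃ Ω : (uniformOmegaRep h F ι₁ V Φ e dV hdV hdV0 ιV (2 * imagUnit F)⁻¹ (fun _ _ => r)).omega (galConj (IsCMField.complexConj F) ν) hν.galConj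
          ((locF ↥(maximalRealSubfield F) (imagUnitSq F) (-1) * ε' : Eps ↥(maximalRealSubfield F) (imagUnitSq F))) (chiInv ↥(maximalRealSubfield F) F (IsCMField.complexConj F) χ') ≃ₗ[ℂ]
          (uniformOmegaRep h F ι₁ V.conj Φ' e dV hdV hdV0 (iotaVConj h F ι₁ V Φ Φ' dV ιV hJc) (2 * imagUnit F)⁻¹ (repConj F (fun _ _ => r))).omega ν hν ε' χ',
        ∀ (g : (sec42DataOf h isoOf F ι₁ V Φ).G)
          (x : (uniformOmegaRep h F ι₁ V Φ e dV hdV hdV0 ιV (2 * imagUnit F)⁻¹ (fun _ _ => r)).omega (galConj (IsCMField.complexConj F) ν) hν.galConj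
            ((locF ↥(maximalRealSubfield F) (imagUnitSq F) (-1) * ε' : Eps ↥(maximalRealSubfield F) (imagUnitSq F))) (chiInv ↥(maximalRealSubfield F) F (IsCMField.complexConj F) χ')),
          Ω ((uniformOmegaRep h F ι₁ V Φ e dV hdV hdV0 ιV (2 * imagUnit F)⁻¹ (fun _ _ => r)).rho (galConj (IsCMField.complexConj F) ν) hν.galConj
              ((locF ↥(maximalRealSubfield F) (imagUnitSq F) (-1) * ε' : Eps ↥(maximalRealSubfield F) (imagUnitSq F))) (chiInv ↥(maximalRealSubfield F) F (IsCMField.complexConj F) χ') g x) =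
            (uniformOmegaRep h F ι₁ V.conj Φ' e dV hdV hdV0 (iotaVConj h F ι₁ V Φ Φ' dV ιV hJc) (2 * imagUnit F)⁻¹ (repConj F (fun _ _ => r))).rho ν hν ε' χ' (phiConj h F ι₁ V Φ Φ' g) (Ω x) :=
    fun ε' χ' => exists_uniformOmegaRep_conj_hermConj h F ι₁ V Φ Φ' e dV ιV (2 * imagUnit F)⁻¹ (fun _ _ => r) (repConj F (fun _ _ => r)) hdV hdV0 hJc ν hν
      ((locF ↥(maximalRealSubfield F) (imagUnitSq F) (-1) * ε' : Eps ↥(maximalRealSubfield F) (imagUnitSq F))) ε' rfl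
      (chiInv ↥(maximalRealSubfield F) F (IsCMField.complexConj F) χ') χ'
      ((congrArg Subtype.val (chiInv_chiInv ↥(maximalRealSubfield F) F (IsCMField.complexConj F) χ')).symm.trans
        (chiInv_val ↥(maximalRealSubfield F) F (IsCMField.complexConj F) _))
  choose Ω hΩ using key
  -- the equivariance clause along `φ := (adelicFinConj V)⁻¹`: `phiConj ((adelicFinConj V)⁻¹ g′) = g′`
  have hΩ' : ∀ (ε' : Eps ↥(maximalRealSubfield F) (imagUnitSq F)) (χ' : Chi ↥(maximalRealSubfield F) F (IsCMField.complexConj F))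
      (g' : (sec42DataOf h isoOf F ι₁ V.conj Φ').G)
      (x : (uniformOmegaRep h F ι₁ V Φ e dV hdV hdV0 ιV (2 * imagUnit F)⁻¹ (fun _ _ => r)).omega (galConj (IsCMField.complexConj F) ν) hν.galConj
        ((locF ↥(maximalRealSubfield F) (imagUnitSq F) (-1) * ε' : Eps ↥(maximalRealSubfield F) (imagUnitSq F)))
        (chiInv ↥(maximalRealSubfield F) F (IsCMField.complexConj F) χ')),
      Ω ε' χ' ((uniformOmegaRep h F ι₁ V Φ e dV hdV hdV0 ιV (2 * imagUnit F)⁻¹ (fun _ _ => r)).rho (galConj (IsCMField.complexConj F) ν) hν.galConj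
          ((locF ↥(maximalRealSubfield F) (imagUnitSq F) (-1) * ε' : Eps ↥(maximalRealSubfield F) (imagUnitSq F)))
          (chiInv ↥(maximalRealSubfield F) F (IsCMField.complexConj F) χ') ((HermSpace3.adelicFinConj V).symm g') x) =
        (uniformOmegaRep h F ι₁ V.conj Φ' e dV hdV hdV0 (iotaVConj h F ι₁ V Φ Φ' dV ιV hJc) (2 * imagUnit F)⁻¹ (repConj F (fun _ _ => r))).rho ν hν ε' χ' g' (Ω ε' χ' x) := by
    intro ε' χ' g' x
    have hg : phiConj h F ι₁ V Φ Φ' ((HermSpace3.adelicFinConj V).symm g') = g' :=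
      ContinuousMulEquiv.apply_symm_apply (HermSpace3.adelicFinConj V) g'
    exact (hΩ ε' χ' ((HermSpace3.adelicFinConj V).symm g') x).trans
      (congrArg (fun y => (uniformOmegaRep h F ι₁ V.conj Φ' e dV hdV hdV0 (iotaVConj h F ι₁ V Φ Φ' dV ιV hJc) (2 * imagUnit F)⁻¹ (repConj F (fun _ _ => r))).rho ν hν ε' χ' y (Ω ε' χ' x)) hg)
  -- (3) §2 along the re-presentation
  exact nonIso_muConj_rest_transport (uniformOmegaRep h F ι₁ V Φ e dV hdV hdV0 ιV (2 * imagUnit F)⁻¹ (fun _ _ => r)) tc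
    (sec42DataOf h isoOf F ι₁ V.conj Φ').G (HermSpace3.adelicFinConj V).symm
    (Eps ↥(maximalRealSubfield F) (imagUnitSq F)) (epsOf ↥(maximalRealSubfield F) (imagUnitSq F) F (2 * imagUnit F)⁻¹)
    (Chi ↥(maximalRealSubfield F) F (IsCMField.complexConj F))
    ((uniformOmegaRep h F ι₁ V.conj Φ' e dV hdV hdV0 (iotaVConj h F ι₁ V Φ Φ' dV ιV hJc) (2 * imagUnit F)⁻¹ (repConj F (fun _ _ => r))).omega ν hν) ((uniformOmegaRep h F ι₁ V.conj Φ' e dV hdV hdV0 (iotaVConj h F ι₁ V Φ Φ' dV ιV hJc) (2 * imagUnit F)⁻¹ (repConj F (fun _ _ => r))).rho ν hν)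
    (epsNegEquiv F)
    (Function.Involutive.toPerm (chiInv ↥(maximalRealSubfield F) F (IsCMField.complexConj F))
      (chiInv_chiInv ↥(maximalRealSubfield F) F (IsCMField.complexConj F)))
    (fun x hx => epsOf_neg_of_complexConj_eq_neg F (2 * imagUnit F)⁻¹ (OmegaTransport.complexConj_inv_two_mul_imagUnit F)
      (OmegaTransport.inv_two_mul_imagUnit_ne_zero F) x hx.2.1 hx.1) Ω hΩ' h2

end HermConj

/-! ## §5 `StubNonIso` (the skeleton's stub type, VERBATIM) from the headline's rows `hD3`, `hD1''` closed over `hDel` (= `HypD3`, `HypD1pp`) -/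

section Stub

set_option synthInstance.maxHeartbeats 400000 in
set_option maxHeartbeats 8000000 in
/-- **`stub_nonIso` REDUCED TO A-IV: [Liu 2021, Thm 4.18 (2)] «the `ℂ[𝔾(𝔸_F^∞)]`-modules in the direct sum are mutually non-isomorphic» AT THE
CONJUGATE SPACE's TRANSPORTED DATUM `D′` of the headline `hc_cm_of_printed_citations_muKey_ident_lemD3_delRecConjOmegaT` — for EVERY `hDel` and
every face prefix `(F, ι₁, V, a, Φ, hΦ, ν, hν, hw, Φ′)` — FROM the headline's displayed rows `hD3` ([App. D Lem. D.1 (3)] AS PRINTED per place on the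
indexed family) and `hD1''` ([Lem. D.1 (1)] AS PRINTED per place), both closed over `hDel` CHARACTER-FOR-CHARACTER as the certificate module's
`PrintedCitationHypotheses.HypD3` ∕ `HypD1pp` (`D2Bridge/PrintedCitationHypothesesT.lean` :101–:131).**  The conclusion is the skeleton's
`StubNonIso` (`Lines/a3-liu418.lean` sha16 131d50a2abf5e9b8 :281–:286) with `NonIso` and `datumC` unfolded: `∀ i j : D′.AdmIndex, D′.AreIsomorphic i j → i = j`.
KERNEL: §4 at the END's objects (`h := DelRec.exists_recordSystem_of_printed hDel`, frame `(e₁, frameD V, ιVE V)` — `ιVE V` onto by ✔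
`finPart_cmKTypeHom_finAdelicToAdelic_surjective` —, section `Rep.update Rep.ofLineOf (locF u_a) u_a rfl`, `n = 3`), the rows read at `(F, V, a, Φ)` and
the label `νᶜ` (weight one by ✔ `HasWeight.galConj_complexConj`).  So item (2) of the binder `hLiu418` costs nothing beyond the A-IV binders; the
unconditional stub is their content (local theta dichotomy, IV-4).  Orientation-free.  HC_CM is proved only modulo the 7 printed citations until rung 0
closes; nothing of [Liu2021] is asserted here (both rows are hypotheses).
[cite: Liu2021, Thm. 4.18 (2) (FJcycle.tex l. 2241) with proof l. 2270 («Statement (2) follows from Lemma D.1»), Def. 4.11–4.12, Rem. 4.4, App. D Lem. D.1 (1), (3) (l. 5226–5233)]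
[cite: FlathCorvallis1979, Theorem 3 (uniqueness clause)] -/
theorem stubNonIso_of_hypD3_hypD1pp
    (hD3 :
  ∀ (hDel : Literature.AlgebraicGeometry.ShimuraVarieties.UnitaryCanonicalModel.canonicalModel_exists_printed),
      ∀ (F : HodgeCM.CMField) [IsGalois ℚ F] (h6 : 6 ≤ Module.finrank ℚ F) {ι₁ : F →+* ℂ} (V : HodgeCM.HermSpace3 F ι₁) (a : RealScalar F)
      (Φ : CMType F) (hΦ : ι₁ ∈ Φ.1) (v : IsDedekindDomain.HeightOneSpectrum (𝓞 ↥(maximalRealSubfield (F : Type)))),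
      LemD1_3AsPrintedI (Def411WeilCarriers.localIndexedFamilyAtV (ι := ((μw : {μ : Literature.NumberTheory.Automorphic.IdeleClassGroup (F : Type) →ₜ* Circle // IdeleClassGroup.IsConjugateSymplectic (F : Type) μ ∧ IdeleClassGroup.HasWeight (F : Type) μ 1}) × (toThm418Data _ (restOfCharDeltaPrime (Summit.HodgeConjecture.CorCM.DelRec.exists_recordSystem_of_printed hDel) ⟨HodgeCM.CMField.K F⟩ h6 ι₁ ⟨HodgeCM.HermSpace3.Hm V, HodgeCM.HermSpace3.isHermitian V, HodgeCM.HermSpace3.signature_ι₁ V, HodgeCM.HermSpace3.posDef_of_ne V⟩ Φ e₁ (frameD V) (frameD_real V) (frameD_ne V) (ιVE V) (Rep.update ↥(maximalRealSubfield (HodgeCM.CMField.K F)) (imagUnitSq (HodgeCM.CMField.K F)) (Rep.ofLineOf ↥(maximalRealSubfield (HodgeCM.CMField.K F)) (imagUnitSq (HodgeCM.CMField.K F))) (locF ↥(maximalRealSubfield (HodgeCM.CMField.K F)) (imagUnitSq (HodgeCM.CMField.K F)) (realUnit ⟨HodgeCM.CMField.K F⟩ a.1 a.2.1 a.2.2))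 (realUnit ⟨HodgeCM.CMField.K F⟩ a.1 a.2.1 a.2.2) rfl) μw.1 μw.2.1 μw.2.2)).AdmIndex)) ↥(maximalRealSubfield (F : Type)) (F : Type) (IsCMField.complexConj (F : Type)) 3 e₁ (Matrix.diagonal (frameD V)) (complexConj_imagUnit (F : Type)) (imagUnit_ne_zero (F : Type)) (imagUnit_mul_self (F : Type)) (realDiagonal_isSymm (F : Type) (frameD V) (frameD_real V)) (isUnit_det_realDiagonal (F : Type) (frameD V) (frameD_real V) (frameD_ne V)) (realDiagonal_map (F : Type) (frameD V) (frameD_real V)).symm (le_refl 3) (fun t => (Rep.update ↥(maximalRealSubfield (HodgeCM.CMField.K F)) (imagUnitSq (HodgeCM.CMField.K F)) (Rep.ofLineOf ↥(maximalRealSubfield (HodgeCM.CMField.K F)) (imagUnitSq (HodgeCM.CMField.K F))) (locF ↥(maximalRealSubfield (HodgeCM.CMField.K F)) (imagUnitSq (HodgeCM.CMField.K F)) (realUnit ⟨HodgeCM.CMField.K F⟩ a.1 a.2.1 a.2.2)) (realUnit ⟨HodgeCM.CMField.K F⟩ a.1 a.2.1 a.2.2) rfl).toFun t.2.1.1) (fun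 t => t.2.1.2) (fun t => OmegaChiSplitting.chiLocalSplittingsD ⟨HodgeCM.CMField.K F⟩ e₁ (frameD V) (frameD_real V) (frameD_ne V) (toHeckeCharacter (F : Type) t.1.1) ((isOscillatorChar_toHeckeCharacter_iff t.1.1).mpr t.1.2.1) ((Rep.update ↥(maximalRealSubfield (HodgeCM.CMField.K F)) (imagUnitSq (HodgeCM.CMField.K F)) (Rep.ofLineOf ↥(maximalRealSubfield (HodgeCM.CMField.K F)) (imagUnitSq (HodgeCM.CMField.K F))) (locF ↥(maximalRealSubfield (HodgeCM.CMField.K F)) (imagUnitSq (HodgeCM.CMField.K F)) (realUnit ⟨HodgeCM.CMField.K F⟩ a.1 a.2.1 a.2.2)) (realUnit ⟨HodgeCM.CMField.K F⟩ a.1 a.2.1 a.2.2) rfl).toFun t.2.1.1)) (fun t => localMu (F : Type) (toHeckeCharacter (F : Type) t.1.1)) (fun t v x => norm_localMu (F : Type) (toHeckeCharacter (F : Type) t.1.1) v (isUnitary_toHeckeCharacter (F : Type) t.1.1) x) (fun t => continuous_localMu (F : Type) (toHeckeCharacter (F : Type) t.1.1)) (fun t v x => localMu_toLocalRing_eq_one_iff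 (F : Type) (toHeckeCharacter (F : Type) t.1.1) v ((isOscillatorChar_toHeckeCharacter_iff t.1.1).mpr t.1.2.1) x) v))
    (hD1pp :
  ∀ (hDel : Literature.AlgebraicGeometry.ShimuraVarieties.UnitaryCanonicalModel.canonicalModel_exists_printed),
      ∀ (F : HodgeCM.CMField) [IsGalois ℚ F] (h6 : 6 ≤ Module.finrank ℚ F) {ι₁ : F →+* ℂ} (V : HodgeCM.HermSpace3 F ι₁) (a : RealScalar F)
      (Φ : CMType F) (hΦ : ι₁ ∈ Φ.1) (μ : Literature.NumberTheory.Automorphic.IdeleClassGroup (F : Type) →ₜ* Circle)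
      (hμ : IdeleClassGroup.IsConjugateSymplectic (F : Type) μ) (hw : IdeleClassGroup.HasWeight (F : Type) μ 1)
      (j : (toThm418Data _ (restOfCharDeltaPrime (Summit.HodgeConjecture.CorCM.DelRec.exists_recordSystem_of_printed hDel) ⟨HodgeCM.CMField.K F⟩ h6 ι₁ ⟨HodgeCM.HermSpace3.Hm V, HodgeCM.HermSpace3.isHermitian V, HodgeCM.HermSpace3.signature_ι₁ V, HodgeCM.HermSpace3.posDef_of_ne V⟩ Φ e₁ (frameD V) (frameD_real V) (frameD_ne V) (ιVE V) (Rep.update ↥(maximalRealSubfield (HodgeCM.CMField.K F)) (imagUnitSq (HodgeCM.CMField.K F)) (Rep.ofLineOf ↥(maximalRealSubfield (HodgeCM.CMField.K F)) (imagUnitSq (HodgeCM.CMField.K F))) (locF ↥(maximalRealSubfield (HodgeCM.CMField.K F)) (imagUnitSq (HodgeCM.CMField.K F)) (realUnit ⟨HodgeCM.CMField.K F⟩ a.1 a.2.1 a.2.2)) (realUnit ⟨HodgeCM.CMField.K F⟩ a.1 a.2.1 a.2.2) rfl) μ hμ hw)).AdmIndex) (v : IsDedekindDomain.HeightOneSpectrum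 (𝓞 ↥(maximalRealSubfield (F : Type)))),
      LemD1_1AsPrinted
        (Def411WeilCarriers.localLemD1Data ↥(maximalRealSubfield (F : Type)) (F : Type) (IsCMField.complexConj (F : Type)) 3 e₁
          (Matrix.diagonal (frameD V)) (complexConj_imagUnit (F : Type)) (imagUnit_ne_zero (F : Type)) (imagUnit_mul_self (F : Type))
          (realDiagonal_isSymm (F : Type) (frameD V) (frameD_real V)) (isUnit_det_realDiagonal (F : Type) (frameD V) (frameD_real V) (frameD_ne V))
          (realDiagonal_map (F : Type) (frameD V) (frameD_real V)).symm (((Rep.update ↥(maximalRealSubfield (HodgeCM.CMField.K F)) (imagUnitSq (HodgeCM.CMField.K F)) (Rep.ofLineOf ↥(maximalRealSubfield (HodgeCM.CMField.K F)) (imagUnitSq (HodgeCM.CMField.K F))) (locF ↥(maximalRealSubfield (HodgeCM.CMField.K F)) (imagUnitSq (HodgeCM.CMField.K F)) (realUnit ⟨HodgeCM.CMField.K F⟩ a.1 a.2.1 a.2.2)) (realUnit ⟨HodgeCM.CMField.K F⟩ a.1 a.2.1 a.2.2) rfl)).toFun j.1.1)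
          (OmegaChiSplitting.chiLocalSplittingsD ⟨HodgeCM.CMField.K F⟩ e₁ (frameD V) (frameD_real V) (frameD_ne V) (toHeckeCharacter (F : Type) μ)
            ((isOscillatorChar_toHeckeCharacter_iff μ).mpr hμ) (((Rep.update ↥(maximalRealSubfield (HodgeCM.CMField.K F)) (imagUnitSq (HodgeCM.CMField.K F)) (Rep.ofLineOf ↥(maximalRealSubfield (HodgeCM.CMField.K F)) (imagUnitSq (HodgeCM.CMField.K F))) (locF ↥(maximalRealSubfield (HodgeCM.CMField.K F)) (imagUnitSq (HodgeCM.CMField.K F)) (realUnit ⟨HodgeCM.CMField.K F⟩ a.1 a.2.1 a.2.2)) (realUnit ⟨HodgeCM.CMField.K F⟩ a.1 a.2.1 a.2.2) rfl)).toFun j.1.1))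
          (le_refl 3) (localMu (F : Type) (toHeckeCharacter (F : Type) μ))
          (fun v x => norm_localMu (F : Type) (toHeckeCharacter (F : Type) μ) v (isUnitary_toHeckeCharacter (F : Type) μ) x)
          (continuous_localMu (F : Type) (toHeckeCharacter (F : Type) μ))
          (fun v t => localMu_toLocalRing_eq_one_iff (F : Type) (toHeckeCharacter (F : Type) μ) v ((isOscillatorChar_toHeckeCharacter_iff μ).mpr hμ) t)
          j.1.2.1
          (Def411WeilCarriers.norm_chi_eq_one ↥(maximalRealSubfield (F : Type)) (F : Type) (IsCMField.complexConj (F : Type))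
            (Algebra.IsQuadraticExtension.finrank_eq_two ↥(maximalRealSubfield (F : Type)) (F : Type))
            (UnitaryGroup.algEquiv_ne_one_of_apply_eq_neg ↥(maximalRealSubfield (F : Type)) (F : Type) (IsCMField.complexConj (F : Type))
              (complexConj_imagUnit (F : Type)) (imagUnit_ne_zero (F : Type))) j.1.2)
          j.1.2.2.1 v))
    :
  ∀ (hDel : Literature.AlgebraicGeometry.ShimuraVarieties.UnitaryCanonicalModel.canonicalModel_exists_printed)
      (F : HodgeCM.CMField) [IsGalois ℚ F] (h6 : 6 ≤ Module.finrank ℚ F) {ι₁ : F →+* ℂ} (V : HodgeCM.HermSpace3 F ι₁) (a : RealScalar F)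
      (Φ : CMType F) (hΦ : ι₁ ∈ Φ.1) (ν : Literature.NumberTheory.Automorphic.IdeleClassGroup (F : Type) →ₜ* Circle)
      (hν : IdeleClassGroup.IsConjugateSymplectic (F : Type) ν) (hw : IdeleClassGroup.HasWeight (F : Type) ν 1) (Φ' : CMType F),
      ∀ i j : (
    (toThm418Data (sec42DataOf (Summit.HodgeConjecture.CorCM.DelRec.exists_recordSystem_of_printed hDel) isoOf ⟨HodgeCM.CMField.K F⟩ ι₁ ⟨HodgeCM.HermSpace3.Hm V, HodgeCM.HermSpace3.isHermitian V, HodgeCM.HermSpace3.signature_ι₁ V, HodgeCM.HermSpace3.posDef_of_ne V⟩ Φ) ((Summit.HodgeConjecture.CorCM.D2Bridge.AdapterMuConj.muConj (uniformOmegaRep (Summit.HodgeConjecture.CorCM.DelRec.exists_recordSystem_of_printed hDel) ⟨HodgeCM.CMField.K F⟩ ι₁ ⟨HodgeCM.HermSpace3.Hm V, HodgeCM.HermSpace3.isHermitian V, HodgeCM.HermSpace3.signature_ι₁ V, HodgeCM.HermSpace3.posDef_of_ne V⟩ Φ e₁ (frameD V) (frameD_real V) (frameD_ne V) (ιVE V)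 (2 * imagUnit (HodgeCM.CMField.K F))⁻¹ (fun _ _ => (Rep.update ↥(maximalRealSubfield (HodgeCM.CMField.K F)) (imagUnitSq (HodgeCM.CMField.K F)) (Rep.ofLineOf ↥(maximalRealSubfield (HodgeCM.CMField.K F)) (imagUnitSq (HodgeCM.CMField.K F))) (locF ↥(maximalRealSubfield (HodgeCM.CMField.K F)) (imagUnitSq (HodgeCM.CMField.K F)) (realUnit ⟨HodgeCM.CMField.K F⟩ a.1 a.2.1 a.2.2)) (realUnit ⟨HodgeCM.CMField.K F⟩ a.1 a.2.1 a.2.2) rfl)))).rest (restTailOne (AlgHom.id ℚ _) ι₁ hν hw (Def45.Carriers.ofPolDR ν (Def45.PolDR ι₁ hν (Def45.RMuForm ι₁ hν))) ((heckeTranslatesFamilyOf heckeTranslate_definedOver_holds (Summit.HodgeConjecture.CorCM.DelRec.exists_recordSystem_of_printed hDel) isoOf ⟨HodgeCM.CMField.K F⟩ ι₁ ⟨HodgeCM.HermSpace3.Hm V, HodgeCM.HermSpace3.isHermitian V, HodgeCM.HermSpace3.signature_ι₁ V, HodgeCM.HermSpace3.posDef_of_ne V⟩ Φ h6).rhoΩOne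 (AlgHom.id ℚ _) ι₁ hν hw (Def45.Carriers.ofPolDR ν (Def45.PolDR ι₁ hν (Def45.RMuForm ι₁ hν))))))).transport
          (sec42DataOf (Summit.HodgeConjecture.CorCM.DelRec.exists_recordSystem_of_printed hDel) isoOf ⟨HodgeCM.CMField.K F⟩ ι₁ (⟨HodgeCM.HermSpace3.Hm V, HodgeCM.HermSpace3.isHermitian V, HodgeCM.HermSpace3.signature_ι₁ V, HodgeCM.HermSpace3.posDef_of_ne V⟩ : Summit.HodgeConjecture.CorCM.HermSpace3 ⟨HodgeCM.CMField.K F⟩ ι₁).conj Φ').G (Summit.HodgeConjecture.CorCM.HermSpace3.adelicFinConj (⟨HodgeCM.HermSpace3.Hm V, HodgeCM.HermSpace3.isHermitian V, HodgeCM.HermSpace3.signature_ι₁ V, HodgeCM.HermSpace3.posDef_of_ne V⟩ : Summit.HodgeConjecture.CorCM.HermSpace3 ⟨HodgeCM.CMField.K F⟩ ι₁)).symm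
          (Literature.NumberTheory.Automorphic.Liu2021.Def411WeilCarriers.Eps ↥(maximalRealSubfield (HodgeCM.CMField.K F)) (imagUnitSq (HodgeCM.CMField.K F))) (Literature.NumberTheory.Automorphic.Liu2021.Def411WeilCarriers.epsOf ↥(maximalRealSubfield (HodgeCM.CMField.K F)) (imagUnitSq (HodgeCM.CMField.K F)) (HodgeCM.CMField.K F) (2 * imagUnit (HodgeCM.CMField.K F))⁻¹)
          (Literature.NumberTheory.Automorphic.Liu2021.Def411WeilCarriers.Chi ↥(maximalRealSubfield (HodgeCM.CMField.K F)) (HodgeCM.CMField.K F) (IsCMField.complexConj (HodgeCM.CMField.K F)))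
          ((uniformOmegaRep (Summit.HodgeConjecture.CorCM.DelRec.exists_recordSystem_of_printed hDel) ⟨HodgeCM.CMField.K F⟩ ι₁ (⟨HodgeCM.HermSpace3.Hm V, HodgeCM.HermSpace3.isHermitian V, HodgeCM.HermSpace3.signature_ι₁ V, HodgeCM.HermSpace3.posDef_of_ne V⟩ : Summit.HodgeConjecture.CorCM.HermSpace3 ⟨HodgeCM.CMField.K F⟩ ι₁).conj Φ' e₁ (frameD V) (frameD_real V) (frameD_ne V) (Summit.HodgeConjecture.CorCM.HComp.OmegaConj.iotaVConj (Summit.HodgeConjecture.CorCM.DelRec.exists_recordSystem_of_printed hDel) ⟨HodgeCM.CMField.K F⟩ ι₁ (⟨HodgeCM.HermSpace3.Hm V, HodgeCM.HermSpace3.isHermitian V, HodgeCM.HermSpace3.signature_ι₁ V, HodgeCM.HermSpace3.posDef_of_ne V⟩ : Summit.HodgeConjecture.CorCM.HermSpace3 ⟨HodgeCM.CMField.K F⟩ ι₁) Φ Φ' (frameD V) (ιVE V) (diagonal_frameD_map_complexConj F V)) (2 * imagUnit (HodgeCM.CMField.K F))⁻¹ (Summit.HodgeConjecture.CorCM.D2Bridge.MuConjIdent.repConj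 ⟨HodgeCM.CMField.K F⟩ (fun _ _ => (Rep.update ↥(maximalRealSubfield (HodgeCM.CMField.K F)) (imagUnitSq (HodgeCM.CMField.K F)) (Rep.ofLineOf ↥(maximalRealSubfield (HodgeCM.CMField.K F)) (imagUnitSq (HodgeCM.CMField.K F))) (locF ↥(maximalRealSubfield (HodgeCM.CMField.K F)) (imagUnitSq (HodgeCM.CMField.K F)) (realUnit ⟨HodgeCM.CMField.K F⟩ a.1 a.2.1 a.2.2)) (realUnit ⟨HodgeCM.CMField.K F⟩ a.1 a.2.1 a.2.2) rfl)))).omega ν hν)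
          ((uniformOmegaRep (Summit.HodgeConjecture.CorCM.DelRec.exists_recordSystem_of_printed hDel) ⟨HodgeCM.CMField.K F⟩ ι₁ (⟨HodgeCM.HermSpace3.Hm V, HodgeCM.HermSpace3.isHermitian V, HodgeCM.HermSpace3.signature_ι₁ V, HodgeCM.HermSpace3.posDef_of_ne V⟩ : Summit.HodgeConjecture.CorCM.HermSpace3 ⟨HodgeCM.CMField.K F⟩ ι₁).conj Φ' e₁ (frameD V) (frameD_real V) (frameD_ne V) (Summit.HodgeConjecture.CorCM.HComp.OmegaConj.iotaVConj (Summit.HodgeConjecture.CorCM.DelRec.exists_recordSystem_of_printed hDel) ⟨HodgeCM.CMField.K F⟩ ι₁ (⟨HodgeCM.HermSpace3.Hm V, HodgeCM.HermSpace3.isHermitian V, HodgeCM.HermSpace3.signature_ι₁ V, HodgeCM.HermSpace3.posDef_of_ne V⟩ : Summit.HodgeConjecture.CorCM.HermSpace3 ⟨HodgeCM.CMField.K F⟩ ι₁) Φ Φ' (frameD V) (ιVE V) (diagonal_frameD_map_complexConj F V)) (2 * imagUnit (HodgeCM.CMField.K F))⁻¹ (Summit.HodgeConjecture.CorCM.D2Bridge.MuConjIdent.repConj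 ⟨HodgeCM.CMField.K F⟩ (fun _ _ => (Rep.update ↥(maximalRealSubfield (HodgeCM.CMField.K F)) (imagUnitSq (HodgeCM.CMField.K F)) (Rep.ofLineOf ↥(maximalRealSubfield (HodgeCM.CMField.K F)) (imagUnitSq (HodgeCM.CMField.K F))) (locF ↥(maximalRealSubfield (HodgeCM.CMField.K F)) (imagUnitSq (HodgeCM.CMField.K F)) (realUnit ⟨HodgeCM.CMField.K F⟩ a.1 a.2.1 a.2.2)) (realUnit ⟨HodgeCM.CMField.K F⟩ a.1 a.2.1 a.2.2) rfl)))).rho ν hν)).AdmIndex, Thm418Data.AreIsomorphic _ i j → i = j := by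
  intro hDel F _ h6 ι₁ V a Φ hΦ ν hν hw Φ'
  exact nonIso_transport_hermConj_of_lemD1AsPrinted (Summit.HodgeConjecture.CorCM.DelRec.exists_recordSystem_of_printed hDel) ⟨HodgeCM.CMField.K F⟩ h6 ι₁
    (⟨HodgeCM.HermSpace3.Hm V, HodgeCM.HermSpace3.isHermitian V, HodgeCM.HermSpace3.signature_ι₁ V, HodgeCM.HermSpace3.posDef_of_ne V⟩ : Summit.HodgeConjecture.CorCM.HermSpace3 ⟨HodgeCM.CMField.K F⟩ ι₁)
    Φ Φ' e₁ (frameD V) (frameD_real V) (frameD_ne V) (diagonal_frameD_map_complexConj F V) (ιVE V)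
    (Rep.update ↥(maximalRealSubfield (HodgeCM.CMField.K F)) (imagUnitSq (HodgeCM.CMField.K F)) (Rep.ofLineOf ↥(maximalRealSubfield (HodgeCM.CMField.K F)) (imagUnitSq (HodgeCM.CMField.K F))) (locF ↥(maximalRealSubfield (HodgeCM.CMField.K F)) (imagUnitSq (HodgeCM.CMField.K F)) (realUnit ⟨HodgeCM.CMField.K F⟩ a.1 a.2.1 a.2.2)) (realUnit ⟨HodgeCM.CMField.K F⟩ a.1 a.2.1 a.2.2) rfl)
    (le_refl 3) (UnitaryDualPair.finPart_cmKTypeHom_finAdelicToAdelic_surjective (F : Type) V.Hm (frameG V) (frameD V) (frame_congr V)) ν hν _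
    hw.galConj_complexConj (fun j v => hD1pp hDel F h6 V a Φ hΦ _ hν.galConj hw.galConj_complexConj j v) (hD3 hDel F h6 V a Φ hΦ)

end Stub

end Summit.HodgeConjecture.CorCM.Lines.A3Liu418

end
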